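import Summits.HodgeConjecture.HodgeConjecture.Theorems.EndoscopicMiddleDegreeMiddleDegreeStepIffBlocks
import Summits.HodgeConjecture.HodgeConjecture.Theorems.OrthogonalEnveloped.Negative.EnvelopeOfAlgebraic

/-!
# Crux idea `cycle-blind-cores` — typed first lemmas (crux-ideate round 2, ideator 5, 2026-08-16)

Crux `stmt-HodgeConjecture-14943` = `EndoscopicMiddleDegree.AlgebraicOrEnveloped`.

The idea's lever is a GALOIS-side theorem (paper): Clifford's theorem + Hodge–Tate regularity of
`r(Ψ_a)` at EVERY embedding of `E` ⟹ no Hecke core carries a potential Tate line ⟹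
`AlgCoreZero` (every core idempotent KILLS `algebraicClasses X n`) and `EnvCoreZero` (every core
idempotent kills every enveloped class; ideator 1's F-A + the same Clifford step). Both are typed
below as `Prop`s over existing declarations (they are HYPOTHESES here; Lean proofs wait for
Betti–étale comparison vocabulary). Everything else in this file is kernel-checked lattice logic:

* `coreHodgeBarren_iff_bet`     : given `AlgCoreZero`, THE BET (registered stub text) ⟺ `CoreHodgeBarren`
                                   (`ε e = 0` for every core `ε` and rational Hodge `(n,n)`-class `e`);
* `algebraicOrEnveloped_of_coreHodgeBarren` : `CoreHodgeBarren → crux` (via the landed p119631);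
* `crux_iff_coreHodgeBarren`     : given `AlgCoreZero ∧ EnvCoreZero`, crux ⟺ `CoreHodgeBarren`;
* `not_hodgeConjecture_of_coreHodgeClass` : given `AlgCoreZero`, ONE core Hodge class refutes the
                                   Hodge conjecture itself (not merely the crux).
-/

noncomputable section

set_option linter.dupNamespace false

namespace Summit.HodgeConjecture.HodgeConjecture.Cruxes.AlgebraicOrEnveloped.CycleBlindCores

open CategoryTheory MonoidalCategory CartesianMonoidalCategory
open Literature.AlgebraicGeometry.Motives (SchemeOver ComplexPoints IsSmoothProjective)
open Literature.AlgebraicGeometry.HodgeTheory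
open Literature.AlgebraicGeometry.ShimuraVarieties
open Literature.AlgebraicTopology.SingularHomology
open Summit.HodgeConjecture.HodgeConjecture.Theses.EndoscopicMiddleDegree
  (AlgebraicOrEnveloped MiddleDegreeStep IsotypicMiddleClassesAlgebraic SectorComplement)
open Summit.HodgeConjecture.HodgeConjecture.Cruxes.MiddleThetaSpan.ConjugateDimensionSieve
  (IsPrimitiveCentralIdempotent)
open Summit.HodgeConjecture.HodgeConjecture.Theorems.CoreSplittingLadder
  (algebraicOrEnveloped_of_bet middleDegreeStep_of_isotypicMiddle_of_bet)
open Summit.HodgeConjecture.HodgeConjecture.Theorems.EndoscopicMiddleDegreeAlgebraicOrEnvelopedCoreHodgeClassesAlgebraicCalibration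
  (coreHodgeClassesAlgebraic_of_middleDegreeStep)
open Summit.HodgeConjecture.HodgeConjecture.Theorems.OrthogonalEnveloped.Negative.EnvelopeOfAlgebraic (Pc)

variable {m : ℕ} {X : SchemeOver ℂ}

/-- The Hecke algebra `𝓗 = ℂ[T_g]` on `H²ⁿ(X(ℂ); ℂ)` (as in the registered bet). -/
abbrev heckeAlg (D : UnitaryBallQuotientDatum (2 * (m + 1)) X) :
    Subalgebra ℂ (Module.End ℂ (complexBetti X (2 * (m + 1)))) :=
  Algebra.adjoin ℂ (Set.range (D.heckeCorrespondenceAction (2 * (m + 1))))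

/-- **A Hecke CORE**: the eight hypotheses on `ε` of the registered bet `stub_coreHodgeClassesAlgebraic`
(in `𝓗`, idempotent, central, rational-preserving, Hodge-type-preserving, primitive among the rational
central idempotents, IMPURE, and UN-KILLED by the coefficient sieve), bundled. -/
def IsCore (D : UnitaryBallQuotientDatum (2 * (m + 1)) X)
    (ε : Module.End ℂ (complexBetti X (2 * (m + 1)))) : Prop :=
  ε ∈ heckeAlg D ∧ ε * ε = ε ∧ (∀ T ∈ heckeAlg D, T * ε = ε * T) ∧
  (∀ β, IsRationalClass β → IsRationalClass (ε β)) ∧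
  (∀ (p q : ℕ) (x : complexBetti X (2 * (m + 1))),
      IsOfHodgeType (2 * (m + 1)) X (2 * (m + 1)) p q x →
      IsOfHodgeType (2 * (m + 1)) X (2 * (m + 1)) p q (ε x)) ∧
  (∀ f ∈ heckeAlg D, f * f = f → (∀ T ∈ heckeAlg D, T * f = f * T) →
      (∀ β, IsRationalClass β → IsRationalClass (f β)) → f * ε = 0 ∨ f * ε = ε) ∧
  (∃ β, ¬ IsOfHodgeType (2 * (m + 1)) X (2 * (m + 1)) (m + 1) (m + 1) (ε β)) ∧
  (∃ z : Module.End ℂ (complexBetti X (2 * (m + 1))),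
      IsPrimitiveCentralIdempotent (heckeAlg D) z ∧ z * ε = z ∧
      ∀ σ : ℂ ≃+* ℂ, ∃ c : complexBetti X (2 * (m + 1)),
        IsOfHodgeType (2 * (m + 1)) X (2 * (m + 1)) (m + 1) (m + 1) (conjEnd σ z c) ∧
          conjEnd σ z c ≠ 0)

/-- A core idempotent is idempotent on vectors. -/
theorem IsCore.apply_apply {D : UnitaryBallQuotientDatum (2 * (m + 1)) X}
    {ε : Module.End ℂ (complexBetti X (2 * (m + 1)))} (hε : IsCore D ε)
    (x : complexBetti X (2 * (m + 1))) : ε (ε x) = ε x := by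
  have h : ε * ε = ε := hε.2.1
  calc ε (ε x) = (ε * ε) x := rfl
    _ = ε x := by rw [h]

/-- **THE BET**, verbatim the registered stub `stub_coreHodgeClassesAlgebraic` / the hypothesis of the
landed `algebraicOrEnveloped_of_bet` (p119631): cores map rational Hodge `(n,n)`-classes INTO
`algebraicClasses X n`. -/
def Bet : Prop :=
  ∀ (m : ℕ) (X : SchemeOver ℂ) (D : UnitaryBallQuotientDatum (2 * (m + 1)) X), 1 ≤ m → m ≤ 2 →
    (∀ a : complexBetti X (2 * m), IsRationalClass a →
      IsOfHodgeType (2 * (m + 1)) X (2 * m) m m a → a ∈ algebraicClasses X m) →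
    ∀ ε : Module.End ℂ (complexBetti X (2 * (m + 1))),
      ε ∈ Algebra.adjoin ℂ (Set.range (D.heckeCorrespondenceAction (2 * (m + 1)))) →
      ε * ε = ε →
      (∀ T ∈ Algebra.adjoin ℂ (Set.range (D.heckeCorrespondenceAction (2 * (m + 1)))),
        T * ε = ε * T) →
      (∀ β, IsRationalClass β → IsRationalClass (ε β)) →
      (∀ (p q : ℕ) (x : complexBetti X (2 * (m + 1))), IsOfHodgeType (2 * (m + 1)) X (2 * (m + 1)) p q x →
        IsOfHodgeType (2 * (m + 1)) X (2 * (m + 1)) p q (ε x)) →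
      (∀ f ∈ Algebra.adjoin ℂ (Set.range (D.heckeCorrespondenceAction (2 * (m + 1)))),
        f * f = f →
        (∀ T ∈ Algebra.adjoin ℂ (Set.range (D.heckeCorrespondenceAction (2 * (m + 1)))),
          T * f = f * T) →
        (∀ β, IsRationalClass β → IsRationalClass (f β)) → f * ε = 0 ∨ f * ε = ε) →
      (∃ β, ¬ IsOfHodgeType (2 * (m + 1)) X (2 * (m + 1)) (m + 1) (m + 1) (ε β)) →
      (∃ z : Module.End ℂ (complexBetti X (2 * (m + 1))),
        IsPrimitiveCentralIdempotent
            (Algebra.adjoin ℂ (Set.range (D.heckeCorrespondenceAction (2 * (m + 1))))) z ∧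
          z * ε = z ∧
            ∀ σ : ℂ ≃+* ℂ, ∃ c : complexBetti X (2 * (m + 1)),
              IsOfHodgeType (2 * (m + 1)) X (2 * (m + 1)) (m + 1) (m + 1) (conjEnd σ z c) ∧
                conjEnd σ z c ≠ 0) →
      ∀ e : complexBetti X (2 * (m + 1)), IsRationalClass e →
        IsOfHodgeType (2 * (m + 1)) X (2 * (m + 1)) (m + 1) (m + 1) e →
        ε e ∈ algebraicClasses X (m + 1)

/-- **`AlgCoreZero` — CORES ARE CYCLE-BLIND (the lever; PAPER THEOREM, typed as a hypothesis).**
Every core idempotent kills `algebraicClasses X n = Nⁿ H²ⁿ`. Paper proof: `ε` is a `ℚ`-combination of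
Hecke correspondences defined over the reflex field, so `ε · cl(Z) = cl(ε_* Z)` is Galois-invariant in
`N_et(n)`; the block's Galois representation is `⊕_σ (r(Ψ_{a₀}^σ) ⊗ χ^σ)|_{G_{E'}}` with `a₀ ≥ 2`
(Kottwitz 1992 / Shin 2011 / KSZ arXiv:2110.05381), `r(Ψ_{a₀})` is irreducible at some `ℓ`
(Patrikis–Taylor arXiv:1307.1640 Thm A; Hui arXiv:2208.04002 Thm 1.4 for `a₀ ≤ 6`) and has `a₀`
DISTINCT Hodge–Tate weights at EVERY embedding of `E`; by Clifford's theorem a `G_L`-invariant line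
(`L/E` finite) forces all constituents of `r(Ψ_{a₀})|_{G_L}` to be conjugate characters of parallel
weight `n`, contradicting regularity unless `a₀ = 1`. -/
def AlgCoreZero : Prop :=
  ∀ (m : ℕ) (X : SchemeOver ℂ) (D : UnitaryBallQuotientDatum (2 * (m + 1)) X), 1 ≤ m → m ≤ 2 →
    ∀ ε : Module.End ℂ (complexBetti X (2 * (m + 1))), IsCore D ε →
      ∀ a ∈ algebraicClasses X (m + 1), ε a = 0

/-- **`CoreHodgeBarren` — the transferred crux `C⁺`:** Hecke cores of compact `U(2n,1)` ball quotients
(`n = 2, 3`) carry NO rational Hodge `(n,n)`-class: `ε e = 0`. No `algebraicClasses`, no envelope, no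
orientation family: a statement about one polarized `ℚ`-Hodge structure with its Hecke symmetry.
(`hlow` is kept only for shape-compatibility with the bet; it is idle.) -/
def CoreHodgeBarren : Prop :=
  ∀ (m : ℕ) (X : SchemeOver ℂ) (D : UnitaryBallQuotientDatum (2 * (m + 1)) X), 1 ≤ m → m ≤ 2 →
    (∀ a : complexBetti X (2 * m), IsRationalClass a →
      IsOfHodgeType (2 * (m + 1)) X (2 * m) m m a → a ∈ algebraicClasses X m) →
    ∀ ε : Module.End ℂ (complexBetti X (2 * (m + 1))), IsCore D ε →
      ∀ e : complexBetti X (2 * (m + 1)), IsRationalClass e →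
        IsOfHodgeType (2 * (m + 1)) X (2 * (m + 1)) (m + 1) (m + 1) e → ε e = 0

/-- **`EnvCoreZero` — cores kill every ENVELOPED class (ideator 1's F-A "enveloped ⟹ potentially Tate"
+ the Clifford step; PAPER THEOREM, typed as a hypothesis).** The generator set is the crux's, in the
disprover's `Pc` spelling (`Pc μ hX γ = ` the crux's inline `P`, by `rfl`). -/
def EnvCoreZero : Prop :=
  ∀ (m : ℕ) (X : SchemeOver ℂ) (D : UnitaryBallQuotientDatum (2 * (m + 1)) X), 1 ≤ m → m ≤ 2 →
    ∀ ε : Module.End ℂ (complexBetti X (2 * (m + 1))), IsCore D ε →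
      ∀ e : complexBetti X (2 * (m + 1)),
        e ∈ {e : complexBetti X (2 * (m + 1)) | IsRationalClass e ∧
          ∃ μ : OrientationFamily, μ.HasPoincareDuality ∧
            ∃ γ ∈ algebraicClasses (X ⊗ X) (2 * (m + 1)),
              (∀ β, IsRationalClass β → IsRationalClass (Pc μ D.isSmoothProjective γ β)) ∧
              (∀ β, IsOfHodgeType (2 * (m + 1)) X (2 * (m + 1)) (m + 1) (m + 1)
                (Pc μ D.isSmoothProjective γ β)) ∧
              Pc μ D.isSmoothProjective γ e = e} → ε e = 0

/-! ## Lattice logic (kernel-checked) -/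

/-- `C⁺ ⟹ bet`: `ε e = 0 ∈ algebraicClasses`. -/
theorem bet_of_coreHodgeBarren (h : CoreHodgeBarren) : Bet := by
  intro m X D hm1 hm2 hlow ε h1 h2 h3 h4 h5 h6 h7 h8 e he hH
  rw [h m X D hm1 hm2 hlow ε ⟨h1, h2, h3, h4, h5, h6, h7, h8⟩ e he hH]
  exact Submodule.zero_mem _

/-- `C⁺ ⟹ crux`, through the landed `algebraicOrEnveloped_of_bet` (p119631). -/
theorem algebraicOrEnveloped_of_coreHodgeBarren (h : CoreHodgeBarren) : AlgebraicOrEnveloped :=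
  algebraicOrEnveloped_of_bet (bet_of_coreHodgeBarren h)

/-- `bet ⟹ C⁺` given cycle-blindness: `ε e ∈ Alg` and `ε e = ε (ε e) ∈ ε(Alg) = 0`. -/
theorem coreHodgeBarren_of_bet (H : AlgCoreZero) (h : Bet) : CoreHodgeBarren := by
  intro m X D hm1 hm2 hlow ε hε e he hH
  obtain ⟨h1, h2, h3, h4, h5, h6, h7, h8⟩ := hε
  have hmem : ε e ∈ algebraicClasses X (m + 1) :=
    h m X D hm1 hm2 hlow ε h1 h2 h3 h4 h5 h6 h7 h8 e he hH
  have hz := H m X D hm1 hm2 ε ⟨h1, h2, h3, h4, h5, h6, h7, h8⟩ (ε e) hmem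
  rwa [IsCore.apply_apply ⟨h1, h2, h3, h4, h5, h6, h7, h8⟩] at hz

/-- **THE BET ⟺ `C⁺`** modulo cycle-blindness of cores. -/
theorem coreHodgeBarren_iff_bet (H : AlgCoreZero) : CoreHodgeBarren ↔ Bet :=
  ⟨bet_of_coreHodgeBarren, coreHodgeBarren_of_bet H⟩

/-- `C⁺` from the route's TARGET (p117875 `coreHodgeClassesAlgebraic_of_middleDegreeStep` + the above). -/
theorem coreHodgeBarren_of_middleDegreeStep (H : AlgCoreZero) (h : MiddleDegreeStep) : CoreHodgeBarren :=
  coreHodgeBarren_of_bet H (coreHodgeClassesAlgebraic_of_middleDegreeStep h)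

/-- The target from the Hodge conjecture (the sector frame, trivially). -/
theorem middleDegreeStep_of_hodgeConjecture (hHC : _root_.HodgeConjecture) : MiddleDegreeStep := by
  intro m X hm1 hm2 hD hlow c hc hH
  obtain ⟨D⟩ := hD
  exact (hHC D.isSmoothProjective).2 (m + 1) c hc hH

/-- **Negative-lemma shape for the disprover: ONE core Hodge class refutes the target …** -/
theorem not_middleDegreeStep_of_coreHodgeClass (H : AlgCoreZero) (w : ¬ CoreHodgeBarren) :
    ¬ MiddleDegreeStep :=
  fun h ↦ w (coreHodgeBarren_of_middleDegreeStep H h)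

/-- **… and the Hodge conjecture itself**: under cycle-blindness a core Hodge class is a NON-ALGEBRAIC
Hodge class (it cannot be "not yet known to be algebraic"). -/
theorem not_hodgeConjecture_of_coreHodgeClass (H : AlgCoreZero) (w : ¬ CoreHodgeBarren) :
    ¬ _root_.HodgeConjecture :=
  fun hHC ↦ not_middleDegreeStep_of_coreHodgeClass H w (middleDegreeStep_of_hodgeConjecture hHC)

/-- `crux ⟹ C⁺` given cycle-blindness and envelope-blindness: apply the crux to `ε e`, then `ε`. -/
theorem coreHodgeBarren_of_crux (H : AlgCoreZero) (H' : EnvCoreZero) (h : AlgebraicOrEnveloped) :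
    CoreHodgeBarren := by
  intro m X D hm1 hm2 hlow ε hε e he hH
  have hrat : IsRationalClass (ε e) := hε.2.2.2.1 e he
  have hHε : IsOfHodgeType (2 * (m + 1)) X (2 * (m + 1)) (m + 1) (m + 1) (ε e) :=
    hε.2.2.2.2.1 _ _ e hH
  have hmem := h m X D hm1 hm2 hlow (ε e) hrat hHε
  rw [Submodule.mem_sup] at hmem
  obtain ⟨a, ha, s, hs, has⟩ := hmem
  have h1 : ε a = 0 := H m X D hm1 hm2 ε hε a ha
  have h2 : ε s = 0 := by
    have hle : _ ≤ LinearMap.ker ε := Submodule.span_le.2 fun e' he' ↦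
      LinearMap.mem_ker.2 (H' m X D hm1 hm2 ε hε e' he')
    exact LinearMap.mem_ker.1 (hle hs)
  calc ε e = ε (ε e) := (IsCore.apply_apply hε e).symm
    _ = ε (a + s) := by rw [has]
    _ = 0 := by rw [map_add, h1, h2, add_zero]

/-- **THE CRUX ⟺ `C⁺`** modulo the two Galois-side paper theorems: `AlgebraicOrEnveloped` needs NO cycle
on cores and NO envelope on cores — it is exactly "cores are Hodge-barren". -/
theorem crux_iff_coreHodgeBarren (H : AlgCoreZero) (H' : EnvCoreZero) :
    AlgebraicOrEnveloped ↔ CoreHodgeBarren :=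
  ⟨coreHodgeBarren_of_crux H H', algebraicOrEnveloped_of_coreHodgeBarren⟩

/-! ## The deciding theorem re-supplied with `C⁺` in place of the crux (shape check for the planner) -/

/-- `closes`-shape: `IsotypicMiddleClassesAlgebraic → CoreHodgeBarren → SectorComplement → HodgeConjecture`,
through p121119's `middleDegreeStep_of_isotypicMiddle_of_bet` — the crux `AlgebraicOrEnveloped` is not on this path. -/
theorem closes_of_coreHodgeBarren (h₁ : IsotypicMiddleClassesAlgebraic) (hB : CoreHodgeBarren)
    (hS : SectorComplement) : _root_.HodgeConjecture :=
  hS (middleDegreeStep_of_isotypicMiddle_of_bet h₁ (bet_of_coreHodgeBarren hB))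

end Summit.HodgeConjecture.HodgeConjecture.Cruxes.AlgebraicOrEnveloped.CycleBlindCores

end
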